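import Summits.SmoothPoincare4.SmoothPoincare4.Theorems.EinsteinBulkPEFillNearRoundRfInteriorEmbedding
import Summits.SmoothPoincare4.SmoothPoincare4.Theorems.EinsteinBulkPEFillNearRoundRfCompactifiedMetric
import Summits.SmoothPoincare4.SmoothPoincare4.Theorems.EinsteinBulkPEFillNearRoundRfUnitNormal
import Summits.SmoothPoincare4.SmoothPoincare4.Theorems.EinsteinBulkPEFillNearRoundRfConformal
import Summits.SmoothPoincare4.SmoothPoincare4.Theorems.EinsteinBulkPEFillNearRoundRfConformalInfinity
import Literature.Geometry.Lorentzian.LeviCivitaProofs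
import Summits.SmoothPoincare4.SmoothPoincare4.Theses.EinsteinBulk

/-!
# The round `S⁴` bounds hyperbolic `5`-space: `EinsteinBulk.RoundSphereBoundsHyperbolicSpace`
# (item stmt-SmoothPoincare4-8003) = registered helper `helper_roundFilled` of crux `PEFillNearRound`
# (stmt-SmoothPoincare4-7997, line `Sketch`: the ROUND CLASS FILLED base point of the continuity method
# for `stub_peFillStandard` / item 18033)

The model Poincaré–Einstein filling, assembled from the registered helper pieces of the lead's
decomposition (all landed under `Theorems/EinsteinBulkPEFillNearRoundRf*.lean`):

* bulk `N = ↥(⊤ : Opens ℝ⁵)`, `g⁺ = g_ℍ` the hyperbolic metric of the hyperboloid graph chart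
  (`Hyperboloid.metric ⊤`; `Ric = -4 g⁺`, `K ≡ -1`: `helper_rf_bulk`, from
  `Hyperboloid.ricci_eq_neg_four_smul` and constant curvature `-1`);
* compactification `X̄ = 𝔻⁵` (closed unit ball, manifold with boundary `𝓡∂ 5`), `j = ballMap`
  (`x = ξ/(1+τ)`, smooth embedding onto the interior: `helper_rf_interiorEmbedding`),
  `ι : 𝕊⁴ ↪ 𝔻⁵` (smooth embedding onto the boundary: `helper_rf_boundaryEmbedding`),
  `ρ = (1 - ‖x‖²)/2` (`helper_rf_definingFunction`), `ḡ = |dx|²` as a `C²` bundle metric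
  (`helper_rf_compactifiedMetric`) with `|dρ|_ḡ = 1` on `∂𝔻⁵` (`helper_rf_unitNormal`),
  `j^*ḡ = ρ² g_ℍ` (`helper_rf_conformal`, Lee 2018 Thm. 3.7 (c)) and `ι^*ḡ = g_round`
  (`helper_rf_conformalInfinity`, conformal factor `φ ≡ 1`);
* boundary metric `g₀ =` the round metric of `𝕊⁴` (`roundMetric`).

References: J. M. Lee, *Introduction to Riemannian Manifolds* (2018), Thm. 3.7 (c), Thm. 8.34 (c);
G. Li, J. Qing, Y. Shi, Trans. AMS 369 (2017), Def. 2.1 and Thm. 1.7 (`ℍⁿ` is the model conformally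
compact Einstein manifold, with conformal infinity the round sphere).
-/

noncomputable section

-- the prescribed namespace `Summit.<P>.<Sub>.…` duplicates `SmoothPoincare4` (P = Sub)
set_option linter.dupNamespace false

open scoped Manifold ContDiff Topology RealInnerProductSpace
open Set Function Metric Bundle TopologicalSpace
open Literature.Geometry.Lorentzian Literature.Geometry.Lorentzian.PseudoRiemannianMetric
open Literature.Geometry.Riemannian Literature.Topology.FourManifolds

namespace Summit.SmoothPoincare4.SmoothPoincare4.Cruxes.PEFillNearRound.RoundFilled


/-! ## The three elementary pieces (registered helpers) -/

/-- **The bulk**: hyperbolic `5`-space (hyperboloid graph chart on all of `ℝ⁵`) is Einstein with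
`Ric = -4 g` and has sectional curvature `-1` on orthonormal pairs (Lee 2018, Thm. 8.34 (c) and
Prop. 8.36; Li–Qing–Shi 2017, Def. 2.1). -/
theorem helper_rf_bulk :
    ∀ [_i : (Hyperboloid.metric (⊤ : TopologicalSpace.Opens (EuclideanSpace ℝ (Fin 5)))).HasLeviCivita],
      (∀ x : ↥(⊤ : TopologicalSpace.Opens (EuclideanSpace ℝ (Fin 5))), (Hyperboloid.metric (⊤ : TopologicalSpace.Opens (EuclideanSpace ℝ (Fin 5)))).ricci x =
        (-4 : ℝ) • (Hyperboloid.metric (⊤ : TopologicalSpace.Opens (EuclideanSpace ℝ (Fin 5)))).toBilinForm x) ∧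
      (∀ (x : ↥(⊤ : TopologicalSpace.Opens (EuclideanSpace ℝ (Fin 5)))) (X Y : TangentSpace (𝓡 5) x), (Hyperboloid.metric (⊤ : TopologicalSpace.Opens (EuclideanSpace ℝ (Fin 5)))).val x X X = 1 →
        (Hyperboloid.metric (⊤ : TopologicalSpace.Opens (EuclideanSpace ℝ (Fin 5)))).val x Y Y = 1 → (Hyperboloid.metric (⊤ : TopologicalSpace.Opens (EuclideanSpace ℝ (Fin 5)))).val x X Y = 0 →
        (Hyperboloid.metric (⊤ : TopologicalSpace.Opens (EuclideanSpace ℝ (Fin 5)))).curvatureForm (Hyperboloid.metric (⊤ : TopologicalSpace.Opens (EuclideanSpace ℝ (Fin 5)))).leviCivita x X Y Y X = -1) := by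
  intro _
  have h5 : Module.finrank ℝ (EuclideanSpace ℝ (Fin 5)) = 5 := finrank_euclideanSpace_fin
  refine ⟨fun x => Hyperboloid.ricci_eq_neg_four_smul h5 x, fun x X Y hX hY hXY => ?_⟩
  rw [(Hyperboloid.hasConstantSectionalCurvatureWith_leviCivita (U := (⊤ : TopologicalSpace.Opens (EuclideanSpace ℝ (Fin 5))))).curvatureForm_pair, hX, hY,
    hXY]
  norm_num

/-- **The boundary**: the inclusion `ι : 𝕊⁴ ↪ 𝔻⁵` is a smooth embedding onto `∂𝔻⁵`
(Lee 2013, Thm. 5.11 with Problem 1-11; tree: `isSmoothEmbedding_sphereInclusion'_holds`,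
`range_inclusion_eq_boundary`). -/
theorem helper_rf_boundaryEmbedding :
    Manifold.IsSmoothEmbedding (𝓡 4) (𝓡∂ 5) ∞ (Set.inclusion (sphere_subset_closedBall : (Metric.sphere (0 : EuclideanSpace ℝ (Fin 5)) 1) ⊆ (Metric.closedBall (0 : EuclideanSpace ℝ (Fin 5)) 1))) ∧
      Set.range (Set.inclusion (sphere_subset_closedBall : (Metric.sphere (0 : EuclideanSpace ℝ (Fin 5)) 1) ⊆ (Metric.closedBall (0 : EuclideanSpace ℝ (Fin 5)) 1))) = (𝓡∂ 5).boundary (Metric.closedBall (0 : EuclideanSpace ℝ (Fin 5)) 1) :=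
  ⟨isSmoothEmbedding_sphereInclusion'_holds 4, range_inclusion_eq_boundary 4⟩

/-- **The defining function** `ρ = (1 - ‖x‖²)/2` of `𝕊⁴ ⊂ 𝔻⁵`: smooth on the manifold with boundary,
nonnegative, vanishing exactly on the boundary (Li–Qing–Shi 2017, Def. 2.1). -/
theorem helper_rf_definingFunction :
    ContMDiff (𝓡∂ 5) 𝓘(ℝ, ℝ) ∞ (fun x : (Metric.closedBall (0 : EuclideanSpace ℝ (Fin 5)) 1) => Hyperboloid.ballDefFn (x : (EuclideanSpace ℝ (Fin 5)))) ∧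
      (∀ x : (Metric.closedBall (0 : EuclideanSpace ℝ (Fin 5)) 1), 0 ≤ Hyperboloid.ballDefFn (x : (EuclideanSpace ℝ (Fin 5)))) ∧
      (∀ x : (Metric.closedBall (0 : EuclideanSpace ℝ (Fin 5)) 1), Hyperboloid.ballDefFn (x : (EuclideanSpace ℝ (Fin 5))) = 0 ↔ x ∈ (𝓡∂ 5).boundary (Metric.closedBall (0 : EuclideanSpace ℝ (Fin 5)) 1)) := by
  refine ⟨Hyperboloid.contDiff_ballDefFn.contMDiff.comp_coe_closedBall,
    fun x => Hyperboloid.ballDefFn_nonneg (mem_closedBall_zero_iff.1 x.2), fun x => ?_⟩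
  rw [Hyperboloid.ballDefFn_eq_zero_iff, boundary_closedBall 4]
  rfl

/-! ## Assembly -/

/-- **The round `S⁴` bounds hyperbolic `5`-space** (`EinsteinBulk.RoundSphereBoundsHyperbolicSpace`,
item stmt-SmoothPoincare4-8003; registered helper `helper_roundFilled` of crux stmt-SmoothPoincare4-7997):
hyperbolic `5`-space `(ℝ⁵, g_ℍ)` is a `C²`-conformally compact Einstein (`Ric = -4g`) filling of the
round `4`-sphere with `K ≡ -1`, compactified on the closed unit ball by `x = ξ/(1+τ)`, `ρ = (1-‖x‖²)/2`,
`ḡ = |dx|²` (Lee 2018, Thm. 3.7 (c); Li–Qing–Shi 2017, Def. 2.1 and Thm. 1.7). -/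
theorem helper_roundFilled : Theses.EinsteinBulk.RoundSphereBoundsHyperbolicSpace := by
  -- the data
  haveI hLC : (Hyperboloid.metric (⊤ : TopologicalSpace.Opens (EuclideanSpace ℝ (Fin 5)))).HasLeviCivita := (Hyperboloid.metric (⊤ : TopologicalSpace.Opens (EuclideanSpace ℝ (Fin 5)))).hasLeviCivita
  set G := Hyperboloid.metric (⊤ : TopologicalSpace.Opens (EuclideanSpace ℝ (Fin 5))) with hG
  set g : Bundle.ContMDiffRiemannianMetric (𝓡 5) ∞ (EuclideanSpace ℝ (Fin 5)) (TangentSpace (𝓡 5) : ↥(⊤ : TopologicalSpace.Opens (EuclideanSpace ℝ (Fin 5))) → Type _) :=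
    G.toContMDiffRiemannianMetric Hyperboloid.isRiemannian_metric with hg
  haveI hLC' : (PseudoRiemannianMetric.ofRiemannian g).HasLeviCivita := hLC
  obtain ⟨hRic, hK⟩ := @helper_rf_bulk hLC
  obtain ⟨gb, hgb⟩ := helper_rf_compactifiedMetric
  refine ⟨(@roundMetric (EuclideanSpace ℝ (Fin 5)) _ _ 4 (fact_finrank_euclideanSpace_succ 4)).toContMDiffRiemannianMetric
      (@isRiemannian_roundMetric (EuclideanSpace ℝ (Fin 5)) _ _ 4 (fact_finrank_euclideanSpace_succ 4)),
    ↥(⊤ : TopologicalSpace.Opens (EuclideanSpace ℝ (Fin 5))), inferInstance, inferInstance, inferInstance, inferInstance, inferInstance, g, hLC', ?_, ?_, ?_⟩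
  · -- Ricci
    intro x
    exact hRic x
  · -- the package
    haveI : CompactSpace (Metric.closedBall (0 : EuclideanSpace ℝ (Fin 5)) 1) := isCompact_iff_compactSpace.1 (isCompact_closedBall _ _)
    haveI : ConnectedSpace (Metric.closedBall (0 : EuclideanSpace ℝ (Fin 5)) 1) :=
      isConnected_iff_connectedSpace.1 ((convex_closedBall (0 : (EuclideanSpace ℝ (Fin 5))) 1).isConnected
        ⟨0, Metric.mem_closedBall_self zero_le_one⟩)
    refine ⟨(Metric.closedBall (0 : EuclideanSpace ℝ (Fin 5)) 1), inferInstance, inferInstance, inferInstance, inferInstance, inferInstance,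
      inferInstance, inferInstance,
      (fun u : ↥(⊤ : TopologicalSpace.Opens (EuclideanSpace ℝ (Fin 5))) => (⟨Hyperboloid.ballMap (u : (EuclideanSpace ℝ (Fin 5))),
          mem_closedBall_zero_iff.2 (Hyperboloid.norm_ballMap_lt_one (u : (EuclideanSpace ℝ (Fin 5)))).le⟩ : (Metric.closedBall (0 : EuclideanSpace ℝ (Fin 5)) 1))),
      Set.inclusion (sphere_subset_closedBall : (Metric.sphere (0 : EuclideanSpace ℝ (Fin 5)) 1) ⊆ (Metric.closedBall (0 : EuclideanSpace ℝ (Fin 5)) 1)),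
      (fun x : (Metric.closedBall (0 : EuclideanSpace ℝ (Fin 5)) 1) => Hyperboloid.ballDefFn (x : (EuclideanSpace ℝ (Fin 5)))), gb,
      helper_rf_interiorEmbedding.1, helper_rf_interiorEmbedding.2,
      helper_rf_boundaryEmbedding.1, helper_rf_boundaryEmbedding.2,
      helper_rf_definingFunction.1, helper_rf_definingFunction.2.1, helper_rf_definingFunction.2.2,
      helper_rf_unitNormal gb hgb, ?_, ⟨fun _ => 1, fun y => ⟨one_pos, fun v w => ?_⟩⟩⟩
    · intro x v w
      rw [helper_rf_conformal gb hgb x v w]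
    · rw [one_mul]
      exact helper_rf_conformalInfinity gb hgb y v w
  · -- K = -1
    intro x X Y hX hY hXY
    exact hK x X Y hX hY hXY

end Summit.SmoothPoincare4.SmoothPoincare4.Cruxes.PEFillNearRound.RoundFilled

end
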